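import Mathlib
import HarnessLib
import Summits.NavierStokesRegularity.NavierStokesRegularity.Theses.IsobarTomography

/-!
# Sketch — crux-ideate stmt-NavierStokesRegularity-11741 (IsobaricLinesLiouville), ideator 2, round 1

First lemmas of the idea card `flux-surface-persistence` (Cruxes/IsobaricLinesLiouville/Ideas/).
They need not be proved here; they must elaborate. All statements are over existing declarations:
`Literature.Analysis.FluidPDE.IsClassicalNSSolutionOn`, `…curl`, `…timeDerivWithin`, Mathlib
`gradient`, the `Δ` of `Laplacian` (instance `Literature.Analysis.FluidPDE.instLaplacian` on `E → F`),
and the route decl `Summit.NavierStokesRegularity.NavierStokesRegularity.Theses.IsobarTomography.IsobaricLinesLiouville`.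
-/

noncomputable section

open MeasureTheory Set Function
open scoped ContDiff Laplacian InnerProductSpace RealInnerProductSpace
open Literature.Analysis.FluidPDE

namespace Summit.NavierStokesRegularity.NavierStokesRegularity.Cruxes.IsobaricLinesLiouville.FluxSurfacePersistence

local notation "ℝ³" => EuclideanSpace ℝ (Fin 3)

/-- The Lagrangian pressure tendency `D_t q = ∂_t q + v·∇q` (time derivative taken within `(-∞,0)`,
the convention of `IsClassicalNSSolutionOn`). In MHD language: the rate at which the isobar through a
fluid particle is exchanged ("slip" of the flux surfaces through the fluid). -/
def matDerivPressure (v : ℝ → ℝ³ → ℝ³) (q : ℝ → ℝ³ → ℝ) (t : ℝ) (x : ℝ³) : ℝ :=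
  timeDerivWithin (Set.Iio 0) q t x + ⟪v t x, gradient (q t) x⟫_ℝ

/-- The Ertel scalar (potential-vorticity density) of the pressure: `Π₀ = ω·∇q`. The crux hypothesis
is `Π₀ ≡ 0` on `(-∞,0) × ℝ³`. -/
def ertelPressure (v : ℝ → ℝ³ → ℝ³) (q : ℝ → ℝ³ → ℝ) (t : ℝ) (x : ℝ³) : ℝ :=
  ⟪curl (v t) x, gradient (q t) x⟫_ℝ

/-- **FIRST LEMMA (viscous Ertel identity for ψ = q; NO isobaric hypothesis).** For a classical
solution of Navier–Stokes (`ν = 1`, `f = 0`) on `(-∞,0) × ℝ³`,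
`(∂_t + v·∇)(ω·∇q) = ω·∇(D_t q) + (Δω)·∇q` pointwise — Ertel's potential-vorticity theorem with
viscosity (Moffatt–Dormy (6.38) with `B ↦ ω`, `u ↦ v`, `η ↦ ν = 1`, `x·u ↦ D_t q`): the stretching
terms cancel exactly. Provable now (C^∞ joint regularity is in `IsClassicalNSSolutionOn`; commute
`∂_t` with `curl`, expand `curl (v × ω) · ∇q`). -/
theorem ertel_pressure_identity
    (v : ℝ → ℝ³ → ℝ³) (q : ℝ → ℝ³ → ℝ)
    (h : IsClassicalNSSolutionOn (Set.Iio 0) 1 0 v q) :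
    ∀ t < 0, ∀ x : ℝ³,
      timeDerivWithin (Set.Iio 0) (ertelPressure v q) t x
        + ⟪v t x, gradient (ertelPressure v q t) x⟫_ℝ
      = ⟪curl (v t) x, gradient (matDerivPressure v q t) x⟫_ℝ
        + ⟪(Δ (curl (v t))) x, gradient (q t) x⟫_ℝ := by
  sorry

/-- **VISCOUS ERTEL LAW for an arbitrary (time-dependent, possibly only locally defined) scalar ψ**
(the generator behind KNSS Thms 5.1–5.3 and the classical anti-dynamo theorems: ψ = x₂ gives Zel'dovich /
Thm 5.1, ψ = azimuth gives ω_θ/r / Thm 5.2, ψ = ½|x|² gives Backus' x·B law):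
`(∂_t + v·∇)(ω·∇ψ) = ω·∇(D_t ψ) + (Δω)·∇ψ`, equivalently
`(∂_t + v·∇ − Δ)(ω·∇ψ) = ω·∇(D_tψ − Δψ) − 2 ∇ω : ∇²ψ`. Verified symbolically (j017099, T1). -/
theorem ertel_general_identity
    (v : ℝ → ℝ³ → ℝ³) (q : ℝ → ℝ³ → ℝ)
    (h : IsClassicalNSSolutionOn (Set.Iio 0) 1 0 v q)
    (ψ : ℝ → ℝ³ → ℝ) (hψ : ContDiffOn ℝ ∞ (uncurry ψ) (Set.Iio 0 ×ˢ Set.univ)) :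
    ∀ t < 0, ∀ x : ℝ³,
      timeDerivWithin (Set.Iio 0) (fun s y => ⟪curl (v s) y, gradient (ψ s) y⟫_ℝ) t x
        + ⟪v t x, gradient (fun y => ⟪curl (v t) y, gradient (ψ t) y⟫_ℝ) x⟫_ℝ
      = ⟪curl (v t) x,
          gradient (fun y => timeDerivWithin (Set.Iio 0) ψ t y + ⟪v t y, gradient (ψ t) y⟫_ℝ) x⟫_ℝ
        + ⟪(Δ (curl (v t))) x, gradient (ψ t) x⟫_ℝ := by
  sorry

/-- **PERSISTENCE IDENTITY (first prolongation `Π₁ = 0` of the isobaric constraint).** If the vortex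
lines are isobaric at all times `t < 0`, then the Lagrangian pressure tendency solves the magnetic
differential equation `ω·∇(D_t q) = −(Δω)·∇q` on every slice. (Immediate from
`ertel_pressure_identity`: the left side there vanishes identically.) -/
theorem persistence_identity
    (v : ℝ → ℝ³ → ℝ³) (q : ℝ → ℝ³ → ℝ)
    (h : IsClassicalNSSolutionOn (Set.Iio 0) 1 0 v q)
    (hiso : ∀ t < 0, ∀ x : ℝ³, ⟪curl (v t) x, gradient (q t) x⟫_ℝ = 0) :
    ∀ t < 0, ∀ x : ℝ³,
      ⟪curl (v t) x, gradient (matDerivPressure v q t) x⟫_ℝ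
        = - ⟪(Δ (curl (v t))) x, gradient (q t) x⟫_ℝ := by
  sorry

/-- **NEWCOMB / subharmonic-Melnikov CONSTRAINT on closed vortex lines.** In the isobaric class, for
every closed vortex line `γ` of a slice `t < 0` (an integral curve of `ω(t)` in vorticity time,
`γ' = ω(t) ∘ γ`, of period `T > 0`) the resistive slip integrates to zero:
`∮_γ (Δω·∇q) ds = 0`. (From `persistence_identity`: the integrand is `−d/ds (D_t q)(γ(s))`, and
`D_t q` is single valued.) These are the solvability conditions (Newcomb 1959) of the magnetic
differential equation for `D_t q`; on rational isobaric tori they come in one-parameter families. -/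
theorem newcomb_closed_vortex_line
    (v : ℝ → ℝ³ → ℝ³) (q : ℝ → ℝ³ → ℝ)
    (h : IsClassicalNSSolutionOn (Set.Iio 0) 1 0 v q)
    (hiso : ∀ t < 0, ∀ x : ℝ³, ⟪curl (v t) x, gradient (q t) x⟫_ℝ = 0)
    {t : ℝ} (ht : t < 0) (γ : ℝ → ℝ³) {T : ℝ} (hT : 0 < T)
    (hγ : ∀ s, HasDerivAt γ (curl (v t) (γ s)) s) (hper : Function.Periodic γ T) :
    ∫ s in (0 : ℝ)..T, ⟪(Δ (curl (v t))) (γ s), gradient (q t) (γ s)⟫_ℝ = 0 := by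
  sorry

/-- The screw Killing field `K_κ(x) = (−x₁, x₀, κ)` (rotation for `κ = 0`). -/
def screwKilling (κ : ℝ) (x : ℝ³) : ℝ³ := WithLp.toLp 2 ![-(x 1), x 0, κ]

/-- **KILLING MOMENTUM LAW (the teeth test).** For every classical NS solution (`ν = 1`, `f = 0`)
and the screw Killing field `K_κ`: `(∂_t + v·∇ − Δ)(v·K_κ) = −K_κ·∇q − 2 ω₂` (`ω₂` = the axial
vorticity component; `∇v : ∇K_κ = ω₂`). Consequence used on the card: a helically symmetric slice
WITHOUT helical swirl (`v·K_κ ≡ 0`, hence `ω = f K_κ`, `K_κ·∇q = 0`, so isobaric) is left by the NS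
flow at rate `−2κ f` — the isobaric class is NOT invariant, and `persistence_identity` then forces
`∇f ∥ ∇q` on such a slice (`Δω·∇q = 2 e₂·(∇f × ∇q)`). For `κ = 0` the law is KNSS (1.8)
(`swirl_transport`). -/
theorem killing_momentum_law
    (v : ℝ → ℝ³ → ℝ³) (q : ℝ → ℝ³ → ℝ)
    (h : IsClassicalNSSolutionOn (Set.Iio 0) 1 0 v q) (κ : ℝ) :
    ∀ t < 0, ∀ x : ℝ³,
      timeDerivWithin (Set.Iio 0) (fun s y => ⟪v s y, screwKilling κ y⟫_ℝ) t x
        + ⟪v t x, gradient (fun y => ⟪v t y, screwKilling κ y⟫_ℝ) x⟫_ℝ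
        - (Δ (fun y => ⟪v t y, screwKilling κ y⟫_ℝ)) x
      = - ⟪screwKilling κ x, gradient (q t) x⟫_ℝ - 2 * (curl (v t) x) 2 := by
  sorry

/-- **ENDGAME SHAPE (symmetric hull ⇒ crux), recorded as the target of the rigidity step.** If every
bounded ancient mild isobaric solution is, on each slice, either planar-type or axisymmetric without
swirl up to a rigid motion (the two NS-invariant Killing-no-swirl classes), the crux follows from the
tree theorems `KNSS2009_liouville_planar_holds` / `knss_axisymmetric_no_swirl_holds`. Stated here only
as the implication the line must eventually instantiate; `HiddenKillingSymmetry` is the bet. -/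
def HiddenKillingSymmetry : Prop :=
  ∀ (v : ℝ → ℝ³ → ℝ³) (q : ℝ → ℝ³ → ℝ),
    IsBoundedAncientMildSolution 1 v → IsClassicalNSSolutionOn (Set.Iio 0) 1 0 v q →
    (∀ t < 0, ∀ x : ℝ³, ⟪curl (v t) x, gradient (q t) x⟫_ℝ = 0) →
    ∀ t < 0, ∃ (a b : ℝ³), ∀ x : ℝ³,
      -- ω(t) is everywhere parallel to one Killing field x ↦ a × (x - b) or x ↦ a (a ≠ 0 allowed 0 ⇒ ω ≡ 0)
      cross (curl (v t) x) (cross a (x - b)) = 0 ∨ cross (curl (v t) x) a = 0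

theorem crux_of_hiddenKilling_and_symmetricLiouville
    (hK : HiddenKillingSymmetry)
    (hSym : ∀ (v : ℝ → ℝ³ → ℝ³) (q : ℝ → ℝ³ → ℝ),
      IsBoundedAncientMildSolution 1 v → IsClassicalNSSolutionOn (Set.Iio 0) 1 0 v q →
      (∀ t < 0, ∃ (a b : ℝ³), ∀ x : ℝ³,
        cross (curl (v t) x) (cross a (x - b)) = 0 ∨ cross (curl (v t) x) a = 0) →
      ∀ t < 0, ∃ c : ℝ³, v t = fun _ => c) :
    Summit.NavierStokesRegularity.NavierStokesRegularity.Theses.IsobarTomography.IsobaricLinesLiouville := by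
  intro v q hv hcl hiso
  exact hSym v q hv hcl (hK v q hv hcl hiso)

end Summit.NavierStokesRegularity.NavierStokesRegularity.Cruxes.IsobaricLinesLiouville.FluxSurfacePersistence

end
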